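import Summits.KontsevichZagierPeriods.KontsevichZagierPeriods.Theorems.LinRedNormalFormArrangementNormalFormSeparateTwoChart

/-!
# Thin sectors at a point of the base plane: the blow-up chart

(Line `janus-bands`, crux `ArrangementNormalForm`, stub `stub_separateTwoPos_hI`, part `HIChart`.)
The measure-theoretic chart of the local analysis of the Taylor pieces at a point `z₁` of the
closed base piece. For a frame `P, Q` of `ℝ²` (`det(P, Q) ≠ 0`) the THIN SECTOR
`sector z₁ P Q δ J = {z₁ + t (P + v Q) | t ∈ (0, δ), v ∈ J}` is the image of the cone
`{w | w₀ ∈ (0, δ), w₁/w₀ ∈ J}` under the affine map `w ↦ z₁ + w₀ P + w₁ Q`; by the change of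
variables formula and the linear chart of part `Chart` (`SepTwo.lintegral_chart`),
`∫⁻_{sector} G = |det(P, Q)| ∫⁻_{t ∈ (0,δ)} t ∫⁻_{v ∈ J} G(z₁ + t (P + v Q))`
(`lintegral_sector`, registered as `separateTwo_hiChart`). Also: membership
(`mem_sector_iff`), the version with `J = [0, ε)` (the ray itself is null, `lintegral_sector_Ico`),
and the SIGN LEMMA `eventually_sign`: finitely many affine forms have, for all small `δ, ε`,
a constant sign on the open sector — so a thin sector lies inside the base polygon or misses it.
-/

noncomputable section

open Set MeasureTheory Filter Topology
open scoped ENNReal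

namespace Summit.KontsevichZagierPeriods.ArrangementNormalForm.JanusBands

namespace SepTwo

/-- The linear frame `w ↦ w₀ P + w₁ Q` of `ℝ²`. -/
def frame (P Q : Fin 2 → ℝ) : (Fin 2 → ℝ) →L[ℝ] (Fin 2 → ℝ) :=
  LinearMap.toContinuousLinearMap (Matrix.toLin' !![P 0, Q 0; P 1, Q 1])

/-- The frame in coordinates. -/
theorem frame_apply (P Q w : Fin 2 → ℝ) (i : Fin 2) : frame P Q w i = w 0 * P i + w 1 * Q i := by
  simp only [frame, LinearMap.coe_toContinuousLinearMap', Matrix.toLin'_apply, Matrix.mulVec,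
    dotProduct, Fin.sum_univ_two]
  fin_cases i <;> simp <;> ring

/-- The determinant of the frame. -/
theorem det_frame (P Q : Fin 2 → ℝ) : (frame P Q).det = P 0 * Q 1 - Q 0 * P 1 := by
  rw [frame, ContinuousLinearMap.det, LinearMap.coe_toContinuousLinearMap, LinearMap.det_toLin',
    Matrix.det_fin_two_of]

/-- The affine chart `w ↦ z₁ + w₀ P + w₁ Q`. -/
def achart (z₁ P Q : Fin 2 → ℝ) (w : Fin 2 → ℝ) : Fin 2 → ℝ := z₁ + frame P Q w

/-- The affine chart in coordinates. -/
theorem achart_apply (z₁ P Q w : Fin 2 → ℝ) (i : Fin 2) :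
    achart z₁ P Q w i = z₁ i + (w 0 * P i + w 1 * Q i) := by
  simp [achart, frame_apply]

/-- The affine chart is injective for a genuine frame. -/
theorem achart_injective (z₁ P Q : Fin 2 → ℝ) (hdet : P 0 * Q 1 - Q 0 * P 1 ≠ 0) :
    Function.Injective (achart z₁ P Q) := by
  intro w w' h
  have h0 := congr_fun h 0
  have h1 := congr_fun h 1
  simp only [achart_apply, add_right_inj] at h0 h1
  have ha : (w 0 - w' 0) * (P 0 * Q 1 - Q 0 * P 1) = 0 := by linear_combination Q 1 * h0 - Q 0 * h1
  have hb : (w 1 - w' 1) * (P 0 * Q 1 - Q 0 * P 1) = 0 := by linear_combination P 0 * h1 - P 1 * h0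
  have ha' : w 0 = w' 0 := by
    rcases mul_eq_zero.1 ha with h | h
    · linarith
    · exact absurd h hdet
  have hb' : w 1 = w' 1 := by
    rcases mul_eq_zero.1 hb with h | h
    · linarith
    · exact absurd h hdet
  funext i
  fin_cases i
  · exact ha'
  · exact hb'

/-- The cone `{w₀ ∈ (0, δ), w₁/w₀ ∈ J}`. -/
def cone (δ : ℝ) (J : Set ℝ) : Set (Fin 2 → ℝ) := {w | w 0 ∈ Ioo 0 δ ∧ (w 1 - 0) / w 0 ∈ J}

/-- The cone is measurable. -/
theorem measurableSet_cone (δ : ℝ) {J : Set ℝ} (hJ : MeasurableSet J) : MeasurableSet (cone δ J) :=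
  (measurable_pi_apply 0 measurableSet_Ioo).inter
    ((((measurable_pi_apply 1).sub_const 0).div (measurable_pi_apply 0)) hJ)

/-- The thin sector `{z₁ + t (P + v Q) | t ∈ (0, δ), v ∈ J}`. -/
def sector (z₁ P Q : Fin 2 → ℝ) (δ : ℝ) (J : Set ℝ) : Set (Fin 2 → ℝ) :=
  achart z₁ P Q '' cone δ J

/-- The point of the sector with blown-up coordinates `(t, v)`. -/
def bpt (z₁ P Q : Fin 2 → ℝ) (t v : ℝ) : Fin 2 → ℝ := fun i => z₁ i + t * (P i + v * Q i)

/-- **Membership in the sector.** -/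
theorem mem_sector_iff (z₁ P Q : Fin 2 → ℝ) (δ : ℝ) (J : Set ℝ) (z : Fin 2 → ℝ) :
    z ∈ sector z₁ P Q δ J ↔ ∃ t ∈ Ioo 0 δ, ∃ v ∈ J, z = bpt z₁ P Q t v := by
  constructor
  · rintro ⟨w, ⟨hw0, hw1⟩, rfl⟩
    rw [sub_zero] at hw1
    refine ⟨w 0, hw0, w 1 / w 0, hw1, funext fun i => ?_⟩
    rw [achart_apply, bpt]
    have h : w 0 ≠ 0 := hw0.1.ne'
    field_simp
  · rintro ⟨t, ht, v, hv, rfl⟩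
    refine ⟨![t, t * v], ⟨by simpa using ht, ?_⟩, funext fun i => ?_⟩
    · have h : t ≠ 0 := ht.1.ne'
      simpa [h] using hv
    · rw [achart_apply, bpt]
      simp only [Matrix.cons_val_zero, Matrix.cons_val_one]
      ring

/-- Points of the sector. -/
theorem bpt_mem_sector {z₁ P Q : Fin 2 → ℝ} {δ : ℝ} {J : Set ℝ} {t v : ℝ} (ht : t ∈ Ioo 0 δ)
    (hv : v ∈ J) : bpt z₁ P Q t v ∈ sector z₁ P Q δ J :=
  (mem_sector_iff z₁ P Q δ J _).2 ⟨t, ht, v, hv, rfl⟩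

/-- Sectors are monotone in the slope set. -/
theorem sector_mono {z₁ P Q : Fin 2 → ℝ} {δ δ' : ℝ} (hδ : δ ≤ δ') {J J' : Set ℝ} (hJ : J ⊆ J') :
    sector z₁ P Q δ J ⊆ sector z₁ P Q δ' J' := by
  intro z hz
  obtain ⟨t, ht, v, hv, rfl⟩ := (mem_sector_iff z₁ P Q δ J z).1 hz
  exact bpt_mem_sector ⟨ht.1, ht.2.trans_le hδ⟩ (hJ hv)

/-- **The sector integral in blown-up coordinates.** See the module docstring. -/
theorem lintegral_sector (z₁ P Q : Fin 2 → ℝ) (hdet : P 0 * Q 1 - Q 0 * P 1 ≠ 0) (δ : ℝ)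
    {J : Set ℝ} (hJ : MeasurableSet J) (G : (Fin 2 → ℝ) → ℝ≥0∞) (hG : Measurable G) :
    ∫⁻ z in sector z₁ P Q δ J, G z = ENNReal.ofReal |P 0 * Q 1 - Q 0 * P 1| *
      ∫⁻ t in Ioo 0 δ, ENNReal.ofReal t * ∫⁻ v in J, G (bpt z₁ P Q t v) := by
  have hd : ∀ w ∈ cone δ J, HasFDerivWithinAt (achart z₁ P Q) (frame P Q) (cone δ J) w :=
    fun w _ => ((frame P Q).hasFDerivAt.const_add z₁).hasFDerivWithinAt
  have hinj : InjOn (achart z₁ P Q) (cone δ J) := (achart_injective z₁ P Q hdet).injOn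
  rw [sector, lintegral_image_eq_lintegral_abs_det_fderiv_mul volume (measurableSet_cone δ hJ) hd
    hinj G]
  simp only [det_frame]
  rw [lintegral_const_mul' _ _ ENNReal.ofReal_ne_top]
  have hGa : Measurable fun w => G (achart z₁ P Q w) := by
    refine hG.comp ?_
    exact (continuous_const.add (frame P Q).continuous).measurable
  have h := lintegral_chart (I := Ioo 0 δ) (J := J) measurableSet_Ioo hJ (b := fun _ => (0 : ℝ))
    (c := fun x => x) measurable_const measurable_id (fun x hx => hx.1.ne') _ hGa
  rw [cone, h]
  congr 1
  refine setLIntegral_congr_fun measurableSet_Ioo fun t ht => ?_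
  rw [abs_of_pos ht.1]
  congr 1
  refine lintegral_congr fun v => ?_
  congr 1
  funext i
  rw [achart_apply, bpt]
  simp only [Matrix.cons_val_zero, Matrix.cons_val_one]
  ring

/-- The sector integral with the ray included: the ray is null. -/
theorem lintegral_sector_Ico (z₁ P Q : Fin 2 → ℝ) (hdet : P 0 * Q 1 - Q 0 * P 1 ≠ 0) (δ ε : ℝ)
    (G : (Fin 2 → ℝ) → ℝ≥0∞) (hG : Measurable G) :
    ∫⁻ z in sector z₁ P Q δ (Ico 0 ε), G z = ENNReal.ofReal |P 0 * Q 1 - Q 0 * P 1| *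
      ∫⁻ t in Ioo 0 δ, ENNReal.ofReal t * ∫⁻ v in Ioo 0 ε, G (bpt z₁ P Q t v) := by
  rw [lintegral_sector z₁ P Q hdet δ measurableSet_Ico G hG]
  congr 1
  refine lintegral_congr fun t => ?_
  rw [setLIntegral_congr Ioo_ae_eq_Ico]

/-! ### The sign lemma -/

/-- One affine form `c₀ + t (p + v q)` has a constant sign on all small open sectors. -/
theorem eventually_sign_one (c₀ p q : ℝ) :
    ∀ᶠ δ in 𝓝[>] (0 : ℝ), ∀ᶠ ε in 𝓝[>] (0 : ℝ),
      (∀ t ∈ Ioo (0 : ℝ) δ, ∀ v ∈ Ioo (0 : ℝ) ε, 0 < c₀ + t * (p + v * q)) ∨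
      (∀ t ∈ Ioo (0 : ℝ) δ, ∀ v ∈ Ioo (0 : ℝ) ε, c₀ + t * (p + v * q) ≤ 0) := by
  have hsmall : ∀ t ∈ Ioo (0 : ℝ) (1 / (2 * (|p| + |q| + 1))), ∀ v ∈ Ioo (0 : ℝ) 1,
      |t * (p + v * q)| ≤ 1 / 2 := by
    intro t ht v hv
    have h1 : |p + v * q| ≤ |p| + |q| + 1 := by
      calc |p + v * q| ≤ |p| + |v * q| := abs_add_le _ _
        _ = |p| + |v| * |q| := by rw [abs_mul]
        _ ≤ |p| + 1 * |q| := by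
            gcongr
            rw [abs_of_pos hv.1]; exact hv.2.le
        _ ≤ |p| + |q| + 1 := by linarith [abs_nonneg q]
    rw [abs_mul, abs_of_pos ht.1]
    have h2 : t * (|p| + |q| + 1) ≤ 1 / 2 := by
      have := ht.2.le
      rw [le_div_iff₀ (by positivity)] at this
      linarith
    calc t * |p + v * q| ≤ t * (|p| + |q| + 1) := mul_le_mul_of_nonneg_left h1 ht.1.le
      _ ≤ 1 / 2 := h2
  rcases lt_trichotomy c₀ 0 with hc | hc | hc
  · -- negative constant term
    filter_upwards [Ioo_mem_nhdsGT (show (0 : ℝ) < -c₀ / (2 * (|p| + |q| + 1)) by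
      apply div_pos <;> nlinarith [abs_nonneg p, abs_nonneg q])] with δ hδ
    filter_upwards [Ioo_mem_nhdsGT one_pos] with ε hε
    refine Or.inr fun t ht v hv => ?_
    have ht' : t / (-c₀) ∈ Ioo (0 : ℝ) (1 / (2 * (|p| + |q| + 1))) := by
      refine ⟨div_pos ht.1 (by linarith), ?_⟩
      rw [div_lt_iff₀ (by linarith)]
      calc t < δ := ht.2
        _ < -c₀ / (2 * (|p| + |q| + 1)) := hδ.2
        _ = 1 / (2 * (|p| + |q| + 1)) * -c₀ := by ring
    have h := hsmall _ ht' v ⟨hv.1, hv.2.trans hε.2⟩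
    rw [abs_le] at h
    have hc0 : c₀ ≠ 0 := hc.ne
    have h3 : t / -c₀ * (p + v * q) * -c₀ = t * (p + v * q) := by field_simp
    nlinarith [h.2]
  · -- vanishing constant term
    subst hc
    rcases lt_trichotomy p 0 with hp | hp | hp
    · filter_upwards [self_mem_nhdsWithin] with δ _
      filter_upwards [Ioo_mem_nhdsGT (show (0 : ℝ) < -p / (2 * (|q| + 1)) by
        apply div_pos <;> nlinarith [abs_nonneg q])] with ε hε
      refine Or.inr fun t ht v hv => ?_
      have hvq : |v * q| ≤ -p / 2 := by
        rw [abs_mul, abs_of_pos hv.1]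
        have h1 : v ≤ -p / (2 * (|q| + 1)) := (hv.2.trans hε.2).le
        calc v * |q| ≤ -p / (2 * (|q| + 1)) * |q| := mul_le_mul_of_nonneg_right h1 (abs_nonneg _)
          _ ≤ -p / 2 := by
              rw [div_mul_eq_mul_div, div_le_div_iff₀ (by positivity) (by positivity)]
              nlinarith [abs_nonneg q]
      have := (abs_le.1 hvq).2
      nlinarith [ht.1]
    · subst hp
      filter_upwards [self_mem_nhdsWithin] with δ _
      filter_upwards [self_mem_nhdsWithin] with ε _
      rcases le_or_gt q 0 with hq | hq
      · exact Or.inr fun t ht v hv => by nlinarith [ht.1, hv.1, mul_pos ht.1 hv.1]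
      · exact Or.inl fun t ht v hv => by nlinarith [mul_pos (mul_pos ht.1 hv.1) hq]
    · filter_upwards [self_mem_nhdsWithin] with δ _
      filter_upwards [Ioo_mem_nhdsGT (show (0 : ℝ) < p / (2 * (|q| + 1)) by positivity)] with ε hε
      refine Or.inl fun t ht v hv => ?_
      have hvq : |v * q| ≤ p / 2 := by
        rw [abs_mul, abs_of_pos hv.1]
        have h1 : v ≤ p / (2 * (|q| + 1)) := (hv.2.trans hε.2).le
        calc v * |q| ≤ p / (2 * (|q| + 1)) * |q| := mul_le_mul_of_nonneg_right h1 (abs_nonneg _)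
          _ ≤ p / 2 := by
              rw [div_mul_eq_mul_div, div_le_div_iff₀ (by positivity) (by positivity)]
              nlinarith [abs_nonneg q]
      have := (abs_le.1 hvq).1
      nlinarith [ht.1]
  · -- positive constant term
    filter_upwards [Ioo_mem_nhdsGT (show (0 : ℝ) < c₀ / (2 * (|p| + |q| + 1)) by positivity)]
      with δ hδ
    filter_upwards [Ioo_mem_nhdsGT one_pos] with ε hε
    refine Or.inl fun t ht v hv => ?_
    have ht' : t / c₀ ∈ Ioo (0 : ℝ) (1 / (2 * (|p| + |q| + 1))) := by
      refine ⟨div_pos ht.1 hc, ?_⟩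
      rw [div_lt_iff₀ hc]
      calc t < δ := ht.2
        _ < c₀ / (2 * (|p| + |q| + 1)) := hδ.2
        _ = 1 / (2 * (|p| + |q| + 1)) * c₀ := by ring
    have h := hsmall _ ht' v ⟨hv.1, hv.2.trans hε.2⟩
    rw [abs_le] at h
    have hc0 : c₀ ≠ 0 := hc.ne'
    have h3 : t / c₀ * (p + v * q) * c₀ = t * (p + v * q) := by field_simp
    nlinarith [h.1]

/-- **The sign lemma.** Finitely many affine forms `c₀ j + t (p j + v q j)` are, for all small
`δ, ε`, either all positive on the open sector `(0, δ) × (0, ε)` or one of them is non-positive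
there. -/
theorem eventually_sign {m : ℕ} (c₀ p q : Fin m → ℝ) :
    ∀ᶠ δ in 𝓝[>] (0 : ℝ), ∀ᶠ ε in 𝓝[>] (0 : ℝ),
      (∀ t ∈ Ioo (0 : ℝ) δ, ∀ v ∈ Ioo (0 : ℝ) ε, ∀ j, 0 < c₀ j + t * (p j + v * q j)) ∨
      (∃ j, ∀ t ∈ Ioo (0 : ℝ) δ, ∀ v ∈ Ioo (0 : ℝ) ε, c₀ j + t * (p j + v * q j) ≤ 0) := by
  have h : ∀ᶠ δ in 𝓝[>] (0 : ℝ), ∀ j, ∀ᶠ ε in 𝓝[>] (0 : ℝ),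
      (∀ t ∈ Ioo (0 : ℝ) δ, ∀ v ∈ Ioo (0 : ℝ) ε, 0 < c₀ j + t * (p j + v * q j)) ∨
      (∀ t ∈ Ioo (0 : ℝ) δ, ∀ v ∈ Ioo (0 : ℝ) ε, c₀ j + t * (p j + v * q j) ≤ 0) :=
    eventually_all.2 fun j => eventually_sign_one (c₀ j) (p j) (q j)
  filter_upwards [h] with δ hδ
  have h2 := eventually_all.2 hδ
  filter_upwards [h2] with ε hε
  by_cases hall : ∀ j, ∀ t ∈ Ioo (0 : ℝ) δ, ∀ v ∈ Ioo (0 : ℝ) ε, 0 < c₀ j + t * (p j + v * q j)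
  · exact Or.inl fun t ht v hv j => hall j t ht v hv
  · push Not at hall
    obtain ⟨j, t, ht, v, hv, hle⟩ := hall
    refine Or.inr ⟨j, ?_⟩
    rcases hε j with h | h
    · exact absurd (h t ht v hv) (not_lt.2 hle)
    · exact h

end SepTwo

/-- **The thin-sector integral in blown-up coordinates** (registered part of
`stub_separateTwoPos_hI`; literal form of `SepTwo.lintegral_sector`): for a frame `P, Q` of the
base plane and a measurable slope set `J`, the lower integral of a measurable `G` over the thin
sector `{z₁ + t (P + v Q) | t ∈ (0, δ), v ∈ J}` (the image of the cone under the affine chart)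
is `|det(P, Q)| ∫⁻_{t ∈ (0,δ)} t ∫⁻_{v ∈ J} G(z₁ + t (P + v Q))`. -/
theorem separateTwo_hiChart (z₁ P Q : Fin 2 → ℝ) (hdet : P 0 * Q 1 - Q 0 * P 1 ≠ 0) (δ : ℝ) (J : Set ℝ) (hJ : MeasurableSet J) (G : (Fin 2 → ℝ) → ENNReal) (hG : Measurable G) : MeasureTheory.lintegral (MeasureTheory.volume.restrict ((fun w : Fin 2 → ℝ => z₁ + LinearMap.toContinuousLinearMap (Matrix.toLin' !![P 0, Q 0; P 1, Q 1]) w) '' {w : Fin 2 → ℝ | w 0 ∈ Set.Ioo 0 δ ∧ (w 1 - 0) / w 0 ∈ J})) G = ENNReal.ofReal |P 0 * Q 1 - Q 0 * P 1| * MeasureTheory.lintegral (MeasureTheory.volume.restrict (Set.Ioo 0 δ)) (fun t => ENNReal.ofReal t * MeasureTheory.lintegral (MeasureTheory.volume.restrict J) (fun v => G (fun i => z₁ i + t * (P i + v * Q i)))) := by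
  exact SepTwo.lintegral_sector z₁ P Q hdet δ hJ G hG

end Summit.KontsevichZagierPeriods.ArrangementNormalForm.JanusBands
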